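import Summits.ABC.IUTFork.Repair.CandInternal2TightCells
import Summits.ABC.IUTFork.Repair.EvalCoarseProfile
import Summits.ABC.IUTFork.Repair.CandMochizuki41
import HarnessLib

/-!
# The §A column on abc-iut-rp-d2's TIGHT bed — the sign-carrier twin of MODEL-SPACE LIMIT #5 rescues no §A row (abc-iut-rp-cx, gen 2)

abc-iut-rp-d2's TIGHT bed `CandInternal2Tight.tightSetting p e` (p444137 ✓; cells p444391 ✓) is the SIGN-CARRIER answer to this
seat's bed request «K-fat»: the (Ind)-trivial sign-shell column of the pinned countermodel family with a LABEL-DEPENDENT typed log-shell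
`p^{e_j}𝒪` in the mono-analytic container, EXACT `j²`-scaled Θ-pilot Kummer images (`tight_scaled`), the three pins for
`(orbitRegion, qDatum)`, BridgeHyps, `|log(q)| > 0`, Step (x) (`tight_adm_iff_image`, `tight_logvolInvariant`), the (xi-f) Licence,
the typed Corollary 3.12 inequality, and `¬S` for EVERY `e` (`tight_not_pilotKummerIndRelated`). At `e⋆ = (0,0,3)` the containers
reading RP-I05 ∧ RP-I05c ∧ RP-I06⋆ ∧ RP-I06 HOLDS (`tight_witness`) — MODEL-SPACE LIMIT #5 closed positively-with-price on the sign
carrier, concordant with abc-iut-w4-d101's moving-carrier family KS(δ) (cx `EvalShellProfile`).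

This file is the cx COLUMN of §A on the TIGHT bed, for EVERY depth `e`, obtained by feeding rp-d2's honest data BY NAME to the seat's
general ceilings (`EvalHonestCeiling`, `EvalHonestCeilingL01`, `CandInternal41Profile`, `CandJoshi1Barrier`): RP-X04a, RP-C01-VT,
RP-C01-GVT, RP-C01-QFC, RP-I17, RP-L01 (every `ρ`, `qK`), RP-M32b (every `ρ`, `qK`), RP-J02 are FALSE for every `e`; RP-I16 and RP-M51
HOLD for every `e` (insufficient: `¬S`). No §A row reads the depth `e`: the sign carrier's SAT⁺ witness of the containers reading, like
the moving carrier's, changes no §A cell (`limit5_tight_witness_sectionA`). PROOF-ONLY: no `def`, nothing restated.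

This file takes NO position on the correctness of [IUTchIII] Corollary 3.12 or on any assessment of it (Mochizuki; Scholze–Stix; Joshi;
Dupuy–Hilado); candidates are hypotheses; typed ≠ endorsed; model data ≠ the intended objects; every cell is a kernel fact about ONE
typed bed.
-/

namespace Summit.ABC.IUTFork.Repair.EvalTightProfile

open Set Cor312 Cor312.Checks Cor312.IdentifiedNonVacuity Cor312Vol Cor312Vol.NaiveWitness Cor312Vol.PinnedWitness
  Literature.IUT.LogThetaLattice Summit.ABC.IUTFork.Repair.CandInternal2 Summit.ABC.IUTFork.Repair.CandInternal2Tight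
open Thm311 hiding toyIndex

variable (p : ℕ) [hp : Fact p.Prime] (e : toyIndex.Label → ℕ)

/-! ## 1. rp-d2's honest data in ceiling shape (BY NAME) -/

/-- The local q-term at a label of `𝔽_l^⋇` is `−log p` (`tight_qRegion_of_ne_zero`, `pVol_pBall`). [folklore] -/
theorem tight_qLocal (i : Fin toyIndex.lstar) (vQ : toyIndex.VQ) :
    (tightSetting p e).qLocal (Setting.labelSucc i) vQ = -Real.log p := by
  unfold Setting.qLocal
  rw [tight_qRegion_of_ne_zero p e (Setting.labelSucc_ne_zero i)]
  show pVol p _ vQ (pBall p _ vQ 1) = _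
  rw [pVol_pBall]; push_cast; ring

/-- … hence negative. [folklore] -/
theorem tight_qLocal_neg (i : Fin toyIndex.lstar) (vQ : toyIndex.VQ) :
    (tightSetting p e).qLocal (Setting.labelSucc i) vQ < 0 := by
  rw [tight_qLocal]; exact neg_neg_of_pos (log_p_pos p)

/-- The q-volume is label-independent. [folklore] -/
theorem tight_indep (i i' : Fin toyIndex.lstar) (vQ : toyIndex.VQ) :
    (tightSetting p e).qLocal (Setting.labelSucc i) vQ = (tightSetting p e).qLocal (Setting.labelSucc i') vQ := by
  rw [tight_qLocal, tight_qLocal]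

/-- Every Kummer image is honestly `j²`-scaled, ceiling shape (`tight_scaled`). [folklore] -/
theorem tight_thetaRegion_logvol (m : ℤ) (i : Fin toyIndex.lstar) (vQ : toyIndex.VQ) :
    ((tightFull p e).toLatticeSituation.D (tightSetting p e).n).logvol _ vQ ((tightSetting p e).thetaRegion m (Setting.labelSucc i) vQ) =
      (((i : ℕ) + 1 : ℕ) : ℝ) ^ 2 * (tightSetting p e).qLocal (Setting.labelSucc i) vQ := by
  have h := tight_scaled p e m i vQ
  have hj : ((jsq (Setting.labelSucc i) : ℚ) : ℝ) = (((i : ℕ) + 1 : ℕ) : ℝ) ^ 2 := by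
    unfold jsq
    rw [show ((Setting.labelSucc i : toyIndex.Label) : ℕ) = (i : ℕ) + 1 from Fin.val_succ i]
    push_cast; ring
  unfold Setting.qLocal
  rw [← hj]; exact h

/-- The (Ind3)-enlarged region is honestly `j²`-scaled, ceiling shape. [folklore] -/
theorem tight_scaled3 (i : Fin toyIndex.lstar) (vQ : toyIndex.VQ) :
    ((tightFull p e).toLatticeSituation.D (tightSetting p e).n).logvol _ vQ ((tightSetting p e).thetaRegion3 (Setting.labelSucc i) vQ) =
      (((i : ℕ) + 1 : ℕ) : ℝ) ^ 2 * (tightSetting p e).qLocal (Setting.labelSucc i) vQ := by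
  rw [tight_thetaRegion3, ← tight_thetaRegion p e 0]; exact tight_thetaRegion_logvol p e 0 i vQ

/-- Admissibility of the (Ind3)-enlarged Θ-regions (they are possible images; `tight_bridgeHyps.image_adm`). [folklore] -/
theorem tight_theta3_adm (i : Fin toyIndex.lstar) (vQ : toyIndex.VQ) :
    ((tightFull p e).toLatticeSituation.D (tightSetting p e).n).Adm _ vQ ((tightSetting p e).thetaRegion3 (Setting.labelSucc i) vQ) :=
  (tight_bridgeHyps p e).image_adm i vQ _ (by rw [tight_possibleImages, tight_thetaRegion3]; exact Set.mem_singleton _)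

/-- Every Kummer image is admissible. [folklore] -/
theorem tight_thetaRegionsAdm : ThetaRegionsAdm (tightSetting p e) := fun m i vQ => by
  rw [tight_thetaRegion, ← tight_thetaRegion3]; exact tight_theta3_adm p e i vQ

omit hp in
/-- The Θ-side column volumes are finitely supported (one place). [folklore] -/
theorem tight_thetaAtFinite (m : ℤ) : CandInternal41.ThetaAtFinite (tightFull p e).toLatticeSituation (tightSetting p e) m :=
  fun _ => Set.toFinite _

/-! ## 2. The column of §A on the TIGHT bed — every row FALSE, for every `e` -/

/-- **RP-X04a ✗ for every `e`.** [folklore] -/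
theorem x04_false_tight : ¬ CandExplicit4.H (tightFull p e).toLatticeSituation (tightSetting p e) :=
  EvalHonestCeiling.x04_false_of_bridgeHyps (tightFull p e).toLatticeSituation (tightSetting p e) (tight_bridgeHyps p e) ⟨1, by decide⟩
    le_rfl () (tight_scaled3 p e _ ()) (tight_qLocal_neg p e _ ())

/-- **RP-C01-VT ✗ for every `e`.** [folklore] -/
theorem volumeTransport_false_tight : ¬ VolumeTransport (tightSetting p e) :=
  EvalHonestCeiling.volumeTransport_false_of_bridgeHyps (tightFull p e).toLatticeSituation (tightSetting p e) (tight_bridgeHyps p e)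
    (tight_thetaRegionsAdm p e) ⟨1, by decide⟩ le_rfl () (tight_scaled3 p e _ ()) (tight_qLocal_neg p e _ ())

/-- **RP-C01-GVT ✗ for every `e`.** [folklore] -/
theorem globalVolumeTransport_false_tight : ¬ GlobalVolumeTransport (tightSetting p e) :=
  EvalHonestCeiling.globalVolumeTransport_false_of_bridgeHyps (tightFull p e).toLatticeSituation (tightSetting p e) (tight_bridgeHyps p e)
    (tight_thetaRegionsAdm p e) (tight_scaled3 p e) (tight_indep p e) (tight_absLogQPos p e)

/-- **RP-C01-QFC ✗ for every `e`** ((ii)(a) `KummerA` from `tightFull_statement`). [folklore] -/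
theorem qFrobComparison_false_tight : ¬ QFrobComparison (S' := (tightFull p e).toLatticeSituation) (tightSetting p e) :=
  EvalHonestCeiling.no_satPlus_qFrobComparison (tightFull p e) (tightSetting p e) () (tightFull_statement p e) (tight_bridgeHyps p e)
    (tight_thetaRegionsAdm p e) (tight_scaled3 p e) (tight_qLocal_neg p e)

/-- **RP-I16 ✓ for every `e`** (`c = 1/PN(j²)`) — insufficient (`¬S`). [folklore] -/
theorem hDegreeOrbit_tight : CandInternal41.HDegreeOrbit (tightFull p e).toLatticeSituation (tightSetting p e) :=
  CandInternal41Profile.hDegreeOrbit_of_scaled _ _ (tight_thetaAtFinite p e) (tight_thetaRegion_logvol p e) (tight_indep p e)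

/-- **RP-I17 = I4d′ ✗ for every `e`.** [folklore] -/
theorem not_hDegreeOrbitGe_tight : ¬ CandInternal41.HDegreeOrbitGe (tightFull p e).toLatticeSituation (tightSetting p e) :=
  CandInternal41Profile.not_hDegreeOrbitGe_of_scaled _ _ (tight_thetaRegion_logvol p e) (tight_indep p e) (tight_absLogQPos p e)

variable (ρ : (∀ v : toyIndex.V, v ∈ toyIndex.Vbad → Set (signShells.StarPacket v)) →
    ∀ (j : toyIndex.Label) (vQ : toyIndex.VQ), Set (signShells.Packet j vQ))
  (qK : ∀ v : toyIndex.V, v ∈ toyIndex.Vbad → Set (signShells.StarPacket v))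

/-- **RP-L01 ✗ for every `e`, `ρ`, `qK`** (cx `l01_false_of_honestData`). [folklore] -/
theorem l01_false_tight : ¬ CandLana1.H (tightFull p e).toLatticeSituation (tightSetting p e) ρ qK :=
  EvalHonestCeilingL01.l01_false_of_honestData (tightFull p e).toLatticeSituation (tightSetting p e) ρ qK (tight_bridgeHyps p e)
    (tight_adm_iff_image p e) (tight_logvolInvariant p e) (tight_scaled3 p e) (tight_indep p e) (tight_absLogQPos p e)

/-- **RP-J02 ✗ for every `e`** (abc-iut-rp-j1's barrier lemma). [folklore] -/
theorem j02_false_tight : ¬ CandJoshi1.JoshiVolumeDominance (tightSetting p e) :=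
  CandJoshi1Barrier.not_joshiVolumeDominance_of_honestAt (S₀ := (tightFull p e).toLatticeSituation.toSituation) (tightSetting p e)
    (tight_adm_iff_image p e) (tight_logvolInvariant p e) ⟨1, by decide⟩ le_rfl () (tight_theta3_adm p e _ ()) (tight_scaled3 p e _ ())
    (tight_qLocal_neg p e _ ())

/-- **RP-M32b ✗ for every `e`, `ρ`, `qK`.** [folklore] -/
theorem m32b_false_tight : ¬ CandMochizuki32.H' (tightFull p e).toLatticeSituation (tightSetting p e) ρ qK := fun h =>
  j02_false_tight p e (EvalCoarseProfile.h'_imp_joshiVolumeDominance _ _ ρ qK h)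

/-! ## 3. RP-M51 on the TIGHT bed — HOLDS for every `e`, insufficient -/

/-- Own volume of the `m`-th Θ-pilot Kummer image at the label `i+1`: `−(i+1)²·log p`, for every `e`. [folklore] -/
theorem ownVolAt_tight (m : ℤ) (i : Fin toyIndex.lstar) (vQ : toyIndex.VQ) :
    CandMochizuki41.ownVolAt (tightFull p e).toLatticeSituation (tightSetting p e) m (Setting.labelSucc i) vQ =
      -((((i : ℕ) + 1 : ℕ) : ℝ) ^ 2) * Real.log p := by
  unfold CandMochizuki41.ownVolAt
  rw [tight_thetaRegion_logvol, tight_qLocal]; ring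

/-- **RP-M51 `H` HOLDS for every `e`**: hull volume `−log p` at the labels `1`, `2` (`tight_thetaLocal`), own volumes `−log p`, `−4·log p`.
[folklore] -/
theorem m41_holds_tight : CandMochizuki41.H (tightFull p e).toLatticeSituation (tightSetting p e) := by
  intro hlin
  obtain ⟨r, hr⟩ := hlin 0 ()
  have h0 := hr ⟨0, by decide⟩
  have h1 := hr ⟨1, by decide⟩
  rw [tight_thetaLocal, ownVolAt_tight, WithTop.coe_eq_coe] at h0 h1
  have hl := log_p_pos p
  push_cast at h0 h1
  nlinarith

/-! ## 4. Package -/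

/-- **THE §A COLUMN ON THE TIGHT BED, for every `e`, with rp-d2's census BY NAME.** Census: typed Thm. 3.11 ✓, BridgeHyps ✓, three pins ✓,
`|log(q)| > 0` ✓, Step (x) ✓, Licence ✓, GapH3 ✓, Statement ✓, `¬S`. Column: X04a, C01-VT, C01-GVT, C01-QFC, I17, L01, M32b, J02 FALSE;
I16 TRUE; M51 TRUE. None reads `e`. [folklore] -/
theorem tight_column_sectionA :
    ((tightFull p e).Statement ∧ BridgeHyps (tightSetting p e) ∧
      PinnedRegions3 (tightFull p e).toLatticeSituation (tightSetting p e) (orbitRegion p) (qDatum p) ∧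
      (tightSetting p e).AbsLogQPos ∧ ((tightFull p e).toLatticeSituation.D (tightSetting p e).n).LogvolInvariant ∧
      Thm311ToCor312.Licence (tightSetting p e) ∧ GapH3 (tightFull p e).toLatticeSituation (tightSetting p e) (orbitRegion p) (qDatum p) ∧
      (tightSetting p e).Statement ∧
      ¬ PilotKummerIndRelated (tightFull p e).toLatticeSituation (tightSetting p e) (orbitRegion p) (qDatum p)) ∧
    (¬ CandExplicit4.H (tightFull p e).toLatticeSituation (tightSetting p e) ∧ ¬ VolumeTransport (tightSetting p e) ∧
      ¬ GlobalVolumeTransport (tightSetting p e) ∧ ¬ QFrobComparison (S' := (tightFull p e).toLatticeSituation) (tightSetting p e) ∧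
      ¬ CandInternal41.HDegreeOrbitGe (tightFull p e).toLatticeSituation (tightSetting p e) ∧
      ¬ CandLana1.H (tightFull p e).toLatticeSituation (tightSetting p e) (orbitRegion p) (qDatum p) ∧
      ¬ CandMochizuki32.H' (tightFull p e).toLatticeSituation (tightSetting p e) (orbitRegion p) (qDatum p) ∧
      ¬ CandJoshi1.JoshiVolumeDominance (tightSetting p e)) ∧
    (CandInternal41.HDegreeOrbit (tightFull p e).toLatticeSituation (tightSetting p e) ∧
      CandMochizuki41.H (tightFull p e).toLatticeSituation (tightSetting p e)) :=
  ⟨⟨tightFull_statement p e, tight_bridgeHyps p e, tight_pinnedRegions3 p e, tight_absLogQPos p e, tight_logvolInvariant p e,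
      tight_licence p e, tight_gapH3 p e, tight_statement p e, tight_not_pilotKummerIndRelated p e⟩,
    ⟨x04_false_tight p e, volumeTransport_false_tight p e, globalVolumeTransport_false_tight p e, qFrobComparison_false_tight p e,
      not_hDegreeOrbitGe_tight p e, l01_false_tight p e _ _, m32b_false_tight p e _ _, j02_false_tight p e⟩,
    ⟨hDegreeOrbit_tight p e, m41_holds_tight p e⟩⟩

/-! ## 5. At `e⋆ = (0,0,3)`: the sign-carrier witness of LIMIT #5 rescues no §A row -/

/-- **MODEL-SPACE LIMIT #5 on the sign carrier, closed from the cx side**: at `tightSetting p eStar` the containers reading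
RP-I05 ∧ RP-I05c ∧ RP-I06⋆ ∧ RP-I06 HOLDS (rp-d2 `tight_witness`, BY NAME) while EVERY §A row is FALSE (§2 at `e := eStar`) and S fails:
concordant with the moving carrier (`EvalShellProfile`). [folklore] -/
theorem limit5_tight_witness_sectionA :
    (HInd3Hull (tightFull p eStar).toLatticeSituation (tightSetting p eStar) (orbitRegion p) ∧
      CandInternal11.H (tightFull p eStar).toLatticeSituation (tightSetting p eStar) (orbitRegion p) ∧
      CandInternal11Gap.HQShellOrbitStar (tightFull p eStar).toLatticeSituation (tightSetting p eStar) (orbitRegion p) (qDatum p) ∧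
      HQShellOrbit (tightFull p eStar).toLatticeSituation (tightSetting p eStar) (orbitRegion p) (qDatum p)) ∧
    (¬ CandExplicit4.H (tightFull p eStar).toLatticeSituation (tightSetting p eStar) ∧ ¬ VolumeTransport (tightSetting p eStar) ∧
      ¬ GlobalVolumeTransport (tightSetting p eStar) ∧
      ¬ QFrobComparison (S' := (tightFull p eStar).toLatticeSituation) (tightSetting p eStar) ∧
      ¬ CandInternal41.HDegreeOrbitGe (tightFull p eStar).toLatticeSituation (tightSetting p eStar) ∧
      ¬ CandLana1.H (tightFull p eStar).toLatticeSituation (tightSetting p eStar) (orbitRegion p) (qDatum p) ∧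
      ¬ CandMochizuki32.H' (tightFull p eStar).toLatticeSituation (tightSetting p eStar) (orbitRegion p) (qDatum p) ∧
      ¬ CandJoshi1.JoshiVolumeDominance (tightSetting p eStar)) ∧
    ¬ PilotKummerIndRelated (tightFull p eStar).toLatticeSituation (tightSetting p eStar) (orbitRegion p) (qDatum p) :=
  have h := tight_witness p
  ⟨⟨h.2.2.2.2.2.1, h.2.2.2.2.2.2.1, h.2.2.2.2.2.2.2.1, h.2.2.2.2.2.2.2.2.1⟩, (tight_column_sectionA p eStar).2.1,
    tight_not_pilotKummerIndRelated p eStar⟩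

end Summit.ABC.IUTFork.Repair.EvalTightProfile
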